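import Summits.RiemannHypothesis.RiemannHypothesis.Theses.WeilGroundState
import Summits.RiemannHypothesis.RiemannHypothesis.Theorems.WeilGroundStateGroundStatesConvergeToXiStubPsiDecay
import Summits.RiemannHypothesis.RiemannHypothesis.Theorems.WeilGroundStateGroundStatesConvergeToXiStubMellinXi
import Summits.RiemannHypothesis.RiemannHypothesis.Theorems.WeilGroundStateGroundStatesConvergeToXiStubPointwiseOfWeak
import Summits.RiemannHypothesis.RiemannHypothesis.Theorems.WeilGroundStateGroundStatesConvergeToXiStubLocallyUniformOfPointwise
import Literature.NumberTheory.LFunctions.WeilExplicit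
import Literature.NumberTheory.LFunctions.WeilGroundState
import Literature.NumberTheory.LFunctions.RiemannXi
import Literature.NumberTheory.LFunctions.RiemannXiFourier
import HarnessLib

/-!
# `WeilGroundState.GroundStatesConvergeToXi` — the transfer theorem of line `Sketch`
(crux item stmt-RiemannHypothesis-1527, route route-RiemannHypothesis-WeilGroundState; `--supports`)

The crux `GroundStatesConvergeToXi` asks for windows `a_k → ∞`, ground states `u_k` of Weil's
truncated quadratic form (`IsWeilGroundState (a k) (u k)`, operator-free) and scalars `c_k ≠ 0`
with `c_k · weilMellin (u k) → riemannXi` locally uniformly on the open critical strip.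

This file composes the four landed RH-free stubs of the line (`stub_psiDecay`, `stub_mellinXi`,
`stub_pointwise_of_weak`, `stub_locallyUniform_of_pointwise`, all in this namespace) into the
TRANSFER THEOREM through Riemann's kernel `Φ(t) = 2Ψ(2t)` (`LagariasMontague.Psic`; `Φ̂ = ξ`):

* `tendstoLocallyUniformlyOn_of_tight_of_weak` — for ANY ground states `u_k` and scalars `c_k`,
  TIGHTNESS of `c_k u_k` in every weighted `L¹(e^{b|t|} dt)`, `b < 1/2`, plus WEAK convergence of
  `c_k u_k` to `Φ` against smooth compactly supported test functions already give locally uniform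
  convergence of `c_k · weilMellin u_k` to `riemannXi` on `{0 < Re s < 1}` (cutoff/tails to the
  real segment `(0,1)`, then Vitali's theorem and the identity theorem).
* `groundStatesConvergeToXi_of_tightWeakLimit` — hence the position-space statement
  C⁺ ("along some `a_k → ∞` the renormalised ground states are tight and converge weakly to `Φ`",
  the registered stub `stub_tightWeakLimit` of the line, which carries the RH-content) implies the
  crux verbatim.

No new definitions; everything RH-free and sorry-free.  The remaining open statement of the line
is exactly the hypothesis of `groundStatesConvergeToXi_of_tightWeakLimit`.
-/

noncomputable section

set_option linter.dupNamespace false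

open scoped Topology Real
open Filter Set MeasureTheory Complex

namespace Summit.RiemannHypothesis.RiemannHypothesis.Theorems.GroundStatesConvergeToXi

open Literature.NumberTheory.LFunctions

/-- **Transfer (RH-free): tightness + weak convergence to Riemann's kernel ⇒ locally uniform
convergence of the transforms to `ξ`.**  For windows `a_k`, ground states `u_k`
(`IsWeilGroundState (a k) (u k)`) and scalars `c_k`: if `c_k u_k` is bounded in every weighted
`L¹(e^{b|t|} dt)`, `b < 1/2`, uniformly in `k`, and `∫ c_k u_k g → ∫ Φ g` for every test function
`g` (`Φ(t) = 2Ψ(2t)`), then `c_k · weilMellin (u k) → riemannXi` locally uniformly on the open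
critical strip.  Composition of the line's stubs: `Φ̂ = ξ` (`stub_mellinXi`, fed by
`stub_psiDecay`), pointwise convergence on the real segment `(0,1)` (`stub_pointwise_of_weak`),
Vitali (`stub_locallyUniform_of_pointwise`). -/
theorem tendstoLocallyUniformlyOn_of_tight_of_weak
    {a : ℕ → ℝ} {u : ℕ → ℝ → ℂ} {c : ℕ → ℂ}
    (hu : ∀ k, IsWeilGroundState (a k) (u k))
    (htight : ∀ b : ℝ, b < 1 / 2 → ∃ M : ℝ, ∀ k, ∫ t, ‖c k * u k t‖ * Real.exp (b * |t|) ≤ M)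
    (hweak : ∀ g : ℝ → ℂ, IsWeilTest g →
      Tendsto (fun k => ∫ t, c k * u k t * g t) atTop
        (𝓝 (∫ t, 2 * LagariasMontague.Psic (2 * t) * g t))) :
    TendstoLocallyUniformlyOn (fun k s => c k * weilMellin (u k) s) riemannXi atTop
      {s : ℂ | 0 < s.re ∧ s.re < 1} :=
  stub_locallyUniform_of_pointwise hu htight fun σ hσ =>
    stub_pointwise_of_weak stub_psiDecay.1 stub_psiDecay.2
      (stub_mellinXi stub_psiDecay.1 stub_psiDecay.2) hu htight hweak σ hσ

/-- **C⁺ implies the crux (RH-free reduction of `GroundStatesConvergeToXi`).**  If along some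
sequence of windows `a_k → ∞` there are ground states `u_k` and scalars `c_k ≠ 0` such that
`c_k u_k` is tight in every weighted `L¹(e^{b|t|} dt)`, `b < 1/2`, and converges weakly (against
smooth compactly supported test functions) to Riemann's kernel `Φ(t) = 2Ψ(2t)`, then the route's
crux `GroundStatesConvergeToXi` holds verbatim: the window clause
`0 < a k ∧ c k ≠ 0 ∧ MemLp (u k) 2 ∧ ∃ g, …` is `IsWeilGroundState (a k) (u k)` unfolded
(`IsWeilGroundState.pos`, `.1`, `.2`), and the convergence clause is
`tendstoLocallyUniformlyOn_of_tight_of_weak`.  The hypothesis is the line's registered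
load-bearing stub `stub_tightWeakLimit` (open; it carries the RH-content of the crux). -/
theorem groundStatesConvergeToXi_of_tightWeakLimit
    (h : ∃ a : ℕ → ℝ, ∃ u : ℕ → ℝ → ℂ, ∃ c : ℕ → ℂ, Tendsto a atTop atTop ∧ (∀ k, c k ≠ 0) ∧
      (∀ k, IsWeilGroundState (a k) (u k)) ∧
      (∀ b : ℝ, b < 1 / 2 → ∃ M : ℝ, ∀ k, ∫ t, ‖c k * u k t‖ * Real.exp (b * |t|) ≤ M) ∧
      (∀ g : ℝ → ℂ, IsWeilTest g →
        Tendsto (fun k => ∫ t, c k * u k t * g t) atTop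
          (𝓝 (∫ t, 2 * LagariasMontague.Psic (2 * t) * g t)))) :
    Summit.RiemannHypothesis.RiemannHypothesis.Theses.WeilGroundState.GroundStatesConvergeToXi := by
  obtain ⟨a, u, c, ha, hc, hu, htight, hweak⟩ := h
  exact ⟨a, u, c, ha, fun k => ⟨(hu k).pos, hc k, (hu k).1, (hu k).2⟩,
    tendstoLocallyUniformlyOn_of_tight_of_weak hu htight hweak⟩

end Summit.RiemannHypothesis.RiemannHypothesis.Theorems.GroundStatesConvergeToXi

end
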